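import Summits.BirchSwinnertonDyer.BirchSwinnertonDyer.Theses.PrintCFram
import HarnessLib

/-!
# Route PrintCFram — the ASSEMBLY item BY NAME (cell `bsd-print-cfram`, seat p4; closes
# stmt-BirchSwinnertonDyer-20375)

HONEST FRAMING (cell `bsd-print-cfram`, run/shared/lean/pub/bsd-print-cfram/, D-0131 (2) print
tier; verbatim in every file of the seat): the cell works the partition leaf
`CornerF ∧ p ramified in the CM field K` (LADDER-BSD row K7r = B13; W-ALL row 12r) in PARTITION
currency — a leaf or a cell counts only when its theorem is in the kernel BY NAME. This file is
PURE LOGIC: the route's assembly decl `Theses.PrintCFram.Assembly`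
(`CMRamifiedThreeBSD → BottomClassIndexLawFiveLe → EllipticUnitIMCFiveLe → PublishedFactsCFram →
WAllCornerFRamified`) is literally the curried form of the planner-authored deciding theorem
`Theses.PrintCFram.closes` (route file, `@[closes]`), so it holds by name. Nothing about any curve
is asserted; the cruxes C1/C2/S3 and the fact bundle S4 remain the route's open hypotheses.
beyond-print: NO. (Planner PLAN v3 §2 TURNKEY, tribunal flag bc6.)
-/

set_option linter.dupNamespace false

namespace Summit.BirchSwinnertonDyer.BirchSwinnertonDyer.Theorems.PrintCFram

/-- **The assembly of route PrintCFram, by name**: the three cruxes and the refereed fact bundle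
imply the leaf `WAllCornerFRamified` — exactly the route's deciding theorem
`Theses.PrintCFram.closes`, curried. [folklore] -/
theorem assembly_holds : Summit.BirchSwinnertonDyer.BirchSwinnertonDyer.Theses.PrintCFram.Assembly := by
  unfold Summit.BirchSwinnertonDyer.BirchSwinnertonDyer.Theses.PrintCFram.Assembly
  exact fun h₁ h₂ h₃ h₄ =>
    Summit.BirchSwinnertonDyer.BirchSwinnertonDyer.Theses.PrintCFram.closes h₁ h₂ h₃ h₄

end Summit.BirchSwinnertonDyer.BirchSwinnertonDyer.Theorems.PrintCFram
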